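import Mathlib.Algebra.Order.Field.Basic
import Mathlib.Algebra.Order.BigOperators.Group.Finset
import Mathlib.Tactic.Linarith
import Mathlib.Tactic.Positivity
import Mathlib.Tactic.Ring
import Mathlib.Tactic.LinearCombination
import Summits.Ventures.CertifiedArithmetic.LowPrec.SRAccumulation
import Summits.Ventures.CertifiedArithmetic.LowPrec.SRLimitedBitsCounts
import HarnessLib

/-!
# Limited-randomness SR (P3109 StochasticA/B/C), II: exact per-step bias and n-step bias bounds

HONEST FRAMING: certified error envelopes and provably optimal rounding/accumulation schemes for
low-precision formats under stated cost models; every table by two implementations; no hardware or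
vendor claims.

* `stepQ F q` — one saturating rounding step into a finite format `F` whose AWAY-from-zero probability
  is `q(η)` instead of `η` (`pUpQ` converts to an up-probability according to the sign of the
  candidates); `stepQ_id_sub` — the per-step bias is EXACTLY `(pUpQ − pUp)·(⌈c̄⌉ − ⌊c̄⌋)`, so
  `|bias| ≤ ε·gap` whenever `|q η − η| ≤ ε` on `[0,1]` (`abs_stepQ_id_sub_le`); StochasticA-type rules
  (`q η ≤ η`) are biased TOWARDS ZERO (`stepQ_towards_zero`);
* `accExpQ` — recursive summation with such steps; `abs_accExpQ_id_sub_le` — with no saturating branch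
  and candidate gaps `≤ G` on every branch, `|E[ŝₙ] − (s + ∑ xₖ)| ≤ n·ε·G`; instances
  `stochasticA_bias_le` (`≤ n G 2^{-N}`), `stochasticB_bias_le`, `stochasticC_bias_le`
  (`≤ n G 2^{-(N+1)}`) — versus `= 0` for exact SR (`accExp_id_of_noSat`).
Kernel-checked FP4 instances: `SRCertificatesFP4LimitedBits`.
-/

namespace Summit.Ventures.CertifiedArithmetic.LowPrec.SR.LimitedBits

open Literature.ComputerArithmetic.P3109
open Literature.ComputerArithmetic.ConnollyHighamMary2021
open Summit.Ventures.CertifiedArithmetic.LowPrec.SR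
open Finset

variable {K : Type*} [Field K] [LinearOrder K] [IsStrictOrderedRing K] [FloorRing K]

/-! ### One saturating step with a perturbed away-probability -/

omit [Field K] [IsStrictOrderedRing K] [FloorRing K] in
/-- The lower candidate is below the upper one. -/
theorem dn_le_up (F : Finset K) (c : K) : dn F c ≤ up F c := roundDown_le_roundUp F _

/-- Up-probability of a saturating rounding step into `F` at `c` whose AWAY-from-zero probability is
`q(η)`: on the nonnegative side (`0 ≤ ⌊c̄⌋`) away = up and `η = θ` (the exact up-probability `pUp`);
on the negative side away = down and `η = 1 − θ`. -/
def pUpQ (F : Finset K) (q : K → K) (c : K) : K :=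
  if 0 ≤ dn F c then q (pUp F c) else 1 - q (1 - pUp F c)

/-- Expectation `E[f(result)]` of one such step. -/
def stepQ (F : Finset K) (q : K → K) (c : K) (f : K → K) : K :=
  pUpQ F q c * f (up F c) + (1 - pUpQ F q c) * f (dn F c)

omit [IsStrictOrderedRing K] [FloorRing K] in
/-- Constants are preserved. -/
theorem stepQ_const (F : Finset K) (q : K → K) (c a : K) : stepQ F q c (fun _ => a) = a := by
  unfold stepQ; ring

omit [IsStrictOrderedRing K] [FloorRing K] in
/-- Additivity in the integrand. -/
theorem stepQ_add (F : Finset K) (q : K → K) (c : K) (f g : K → K) :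
    stepQ F q c (fun t => f t + g t) = stepQ F q c f + stepQ F q c g := by
  unfold stepQ; ring

omit [FloorRing K] in
/-- **Exact per-step bias**: `E[result] − c̄ = (pUpQ − pUp)·(⌈c̄⌉ − ⌊c̄⌋)`. -/
theorem stepQ_id_sub (F : Finset K) (q : K → K) (c : K) :
    stepQ F q c (fun t => t) - clamp F c = (pUpQ F q c - pUp F c) * (up F c - dn F c) := by
  have h := step_id F c
  unfold step at h
  unfold stepQ
  linear_combination h

omit [FloorRing K] in
/-- The up-probability perturbation is bounded by the away-probability perturbation on `[0,1]`. -/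
theorem abs_pUpQ_sub_le (F : Finset K) {q : K → K} {ε : K}
    (hq : ∀ η, 0 ≤ η → η ≤ 1 → |q η - η| ≤ ε) (c : K) : |pUpQ F q c - pUp F c| ≤ ε := by
  have h0 := pUp_nonneg F c
  have h1 := pUp_le_one F c
  unfold pUpQ
  split_ifs
  · exact hq _ h0 h1
  · have := hq (1 - pUp F c) (by linarith) (by linarith)
    rw [show 1 - q (1 - pUp F c) - pUp F c = -(q (1 - pUp F c) - (1 - pUp F c)) by ring, abs_neg]
    exact this

omit [FloorRing K] in
/-- With `|q η − η| ≤ ε` on `[0,1]`, the up-probability `pUpQ` lies in `[−ε, 1+ε]`; if moreover `q` maps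
`[0,1]` into `[0,1]` it is a genuine probability. -/
theorem pUpQ_mem (F : Finset K) {q : K → K} (hq01 : ∀ η, 0 ≤ η → η ≤ 1 → 0 ≤ q η ∧ q η ≤ 1)
    (c : K) : 0 ≤ pUpQ F q c ∧ pUpQ F q c ≤ 1 := by
  have h0 := pUp_nonneg F c
  have h1 := pUp_le_one F c
  unfold pUpQ
  split_ifs
  · exact hq01 _ h0 h1
  · obtain ⟨a, b⟩ := hq01 (1 - pUp F c) (by linarith) (by linarith)
    constructor <;> linarith

omit [FloorRing K] in
/-- **Per-step bias bound**: `|E[result] − c̄| ≤ ε·(⌈c̄⌉ − ⌊c̄⌋)`. -/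
theorem abs_stepQ_id_sub_le (F : Finset K) {q : K → K} {ε : K}
    (hq : ∀ η, 0 ≤ η → η ≤ 1 → |q η - η| ≤ ε) (c : K) :
    |stepQ F q c (fun t => t) - clamp F c| ≤ ε * (up F c - dn F c) := by
  rw [stepQ_id_sub, abs_mul, abs_of_nonneg (sub_nonneg.mpr (dn_le_up F c))]
  exact mul_le_mul_of_nonneg_right (abs_pUpQ_sub_le F hq c) (sub_nonneg.mpr (dn_le_up F c))

omit [FloorRing K] in
/-- **StochasticA-type rules are biased towards zero**: if `q η ≤ η` on `[0,1]` then the mean result is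
`≤ c̄` when the candidates are nonnegative and `≥ c̄` when they are negative. -/
theorem stepQ_towards_zero (F : Finset K) {q : K → K} (hq : ∀ η, 0 ≤ η → η ≤ 1 → q η ≤ η) (c : K) :
    (0 ≤ dn F c → stepQ F q c (fun t => t) ≤ clamp F c) ∧
    (dn F c < 0 → clamp F c ≤ stepQ F q c (fun t => t)) := by
  have h0 := pUp_nonneg F c
  have h1 := pUp_le_one F c
  have hg : 0 ≤ up F c - dn F c := sub_nonneg.mpr (dn_le_up F c)
  have key := stepQ_id_sub F q c
  constructor
  · intro hd
    have : pUpQ F q c - pUp F c ≤ 0 := by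
      unfold pUpQ; rw [if_pos hd]; linarith [hq _ h0 h1]
    nlinarith
  · intro hd
    have : 0 ≤ pUpQ F q c - pUp F c := by
      unfold pUpQ; rw [if_neg (not_le.mpr hd)]
      linarith [hq (1 - pUp F c) (by linarith) (by linarith)]
    nlinarith

/-! ### Recursive summation with perturbed steps: n-step bias bound -/

/-- `E[f(ŝₙ)]` for `ŝ₀ = s`, `ŝₖ₊₁ =` (perturbed-SR step of `ŝₖ + xₖ`), as a backward recursion. -/
def accExpQ (F : Finset K) (q : K → K) : (ℕ → K) → ℕ → (K → K) → K → K
  | _, 0, f, s => f s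
  | x, n + 1, f, s => stepQ F q (s + x 0) (accExpQ F q (fun i => x (i + 1)) n f)

omit [FloorRing K] in
/-- **n-step bias bound for limited-randomness SR**: if `q` maps `[0,1]` into `[0,1]` with
`|q η − η| ≤ ε`, no branch saturates and every candidate gap is `≤ G`, then
`|E[ŝₙ] − (s + ∑_{k<n} xₖ)| ≤ n·ε·G`. (Exact SR: `= 0`, `accExp_id_of_noSat`.) -/
theorem abs_accExpQ_id_sub_le (F : Finset K) {q : K → K} {ε G : K}
    (hq01 : ∀ η, 0 ≤ η → η ≤ 1 → 0 ≤ q η ∧ q η ≤ 1) (hq : ∀ η, 0 ≤ η → η ≤ 1 → |q η - η| ≤ ε) :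
    ∀ (x : ℕ → K) (n : ℕ) (s : K), NoSat F x n s → GapLE F G x n s →
      |accExpQ F q x n (fun t => t) s - (s + ∑ i ∈ range n, x i)| ≤ n * (ε * G) := by
  intro x n
  induction n generalizing x with
  | zero => intro s _ _; simp [accExpQ]
  | succ n ih =>
    intro s hns hgap
    obtain ⟨hin, hnu, hnd⟩ := hns
    obtain ⟨hg, hgu, hgd⟩ := hgap
    set c := s + x 0 with hc
    have hcl : clamp F c = c := clamp_eq_self hin
    -- decompose the inner expectation on each branch
    set x' : ℕ → K := fun i => x (i + 1) with hx'
    set S' : K := ∑ i ∈ range n, x' i with hS'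
    set r : K → K := fun t => accExpQ F q x' n (fun t => t) t - (t + S') with hr
    have hru : |r (up F c)| ≤ n * (ε * G) := ih x' (up F c) hnu hgu
    have hrd : |r (dn F c)| ≤ n * (ε * G) := ih x' (dn F c) hnd hgd
    have hsplit : accExpQ F q x (n + 1) (fun t => t) s
        = stepQ F q c (fun t => t) + S' + stepQ F q c r := by
      show stepQ F q c (accExpQ F q x' n (fun t => t)) = _
      have : (accExpQ F q x' n fun t => t) = fun t => (t + S') + r t := by
        funext t; simp [hr]
      rw [this, stepQ_add, stepQ_add, stepQ_const]
    have hsum : s + ∑ i ∈ range (n + 1), x i = c + S' := by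
      rw [Finset.sum_range_succ', hc, hS']; ring
    rw [hsplit, hsum]
    have h1 : |stepQ F q c (fun t => t) - c| ≤ ε * G := by
      have := abs_stepQ_id_sub_le F hq c
      rw [hcl] at this
      refine this.trans ?_
      have hε : 0 ≤ ε := (abs_nonneg _).trans (hq 0 le_rfl zero_le_one)
      have hg' : up F c - dn F c ≤ G := hg
      exact mul_le_mul_of_nonneg_left hg' hε
    have h2 : |stepQ F q c r| ≤ n * (ε * G) := by
      obtain ⟨hp0, hp1⟩ := pUpQ_mem F hq01 c
      unfold stepQ
      calc |pUpQ F q c * r (up F c) + (1 - pUpQ F q c) * r (dn F c)|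
          ≤ |pUpQ F q c * r (up F c)| + |(1 - pUpQ F q c) * r (dn F c)| := abs_add_le _ _
        _ = pUpQ F q c * |r (up F c)| + (1 - pUpQ F q c) * |r (dn F c)| := by
            rw [abs_mul, abs_mul, abs_of_nonneg hp0, abs_of_nonneg (sub_nonneg.mpr hp1)]
        _ ≤ pUpQ F q c * (n * (ε * G)) + (1 - pUpQ F q c) * (n * (ε * G)) :=
            add_le_add (mul_le_mul_of_nonneg_left hru hp0)
              (mul_le_mul_of_nonneg_left hrd (sub_nonneg.mpr hp1))
        _ = n * (ε * G) := by ring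
    calc |stepQ F q c (fun t => t) + S' + stepQ F q c r - (c + S')|
        = |(stepQ F q c (fun t => t) - c) + stepQ F q c r| := by ring_nf
      _ ≤ |stepQ F q c (fun t => t) - c| + |stepQ F q c r| := abs_add_le _ _
      _ ≤ ε * G + n * (ε * G) := add_le_add h1 h2
      _ = (↑(n + 1) : K) * (ε * G) := by push_cast; ring

/-! ### The three P3109 rules, n steps -/

/-- **StochasticA, n steps**: `|E[ŝₙ] − (s + ∑ xₖ)| ≤ n·G·2^{-N}` (no saturating branch, gaps `≤ G`). -/
theorem stochasticA_bias_le (F : Finset K) (N : ℕ) {G : K} (x : ℕ → K) (n : ℕ)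
    (s : K) (hns : NoSat F x n s) (hg : GapLE F G x n s) :
    |accExpQ F (probAwayA N) x n (fun t => t) s - (s + ∑ i ∈ range n, x i)|
      ≤ n * (1 / 2 ^ N * G) :=
  abs_accExpQ_id_sub_le F (probAwayA_mem N) (fun η _ _ => abs_probAwayA_sub_le N η) x n s hns hg

/-- **StochasticB, n steps**: `|E[ŝₙ] − (s + ∑ xₖ)| ≤ n·G·2^{-(N+1)}`. -/
theorem stochasticB_bias_le (F : Finset K) (N : ℕ) {G : K} (x : ℕ → K) (n : ℕ)
    (s : K) (hns : NoSat F x n s) (hg : GapLE F G x n s) :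
    |accExpQ F (probAwayB N) x n (fun t => t) s - (s + ∑ i ∈ range n, x i)|
      ≤ n * (1 / 2 ^ (N + 1) * G) :=
  abs_accExpQ_id_sub_le F (probAwayB_mem N) (fun η _ _ => abs_probAwayB_sub_le N η) x n s hns hg

/-- **StochasticC, n steps**: `|E[ŝₙ] − (s + ∑ xₖ)| ≤ n·G·2^{-(N+1)}`. -/
theorem stochasticC_bias_le (F : Finset K) (N : ℕ) {G : K} (x : ℕ → K) (n : ℕ)
    (s : K) (hns : NoSat F x n s) (hg : GapLE F G x n s) :
    |accExpQ F (probAwayC N) x n (fun t => t) s - (s + ∑ i ∈ range n, x i)|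
      ≤ n * (1 / 2 ^ (N + 1) * G) :=
  abs_accExpQ_id_sub_le F (probAwayC_mem N) (fun η _ _ => abs_probAwayC_sub_le N η) x n s hns hg

/-- **One StochasticA step is biased towards zero** (mean `≤ c̄` on the nonnegative side, `≥ c̄` on the
negative side), with `|bias| ≤ 2^{-N}·gap`. -/
theorem stochasticA_step_towards_zero (F : Finset K) (N : ℕ) (c : K) :
    (0 ≤ dn F c → stepQ F (probAwayA N) c (fun t => t) ≤ clamp F c) ∧
    (dn F c < 0 → clamp F c ≤ stepQ F (probAwayA N) c (fun t => t)) :=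
  stepQ_towards_zero F (fun η _ _ => probAwayA_le N η) c

end Summit.Ventures.CertifiedArithmetic.LowPrec.SR.LimitedBits
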